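import Literature.NumberTheory.Transcendental.KroneckerRationalityCriterion
import Mathlib.Analysis.Complex.CauchyIntegral
import Mathlib.Analysis.Analytic.OfScalars
import Mathlib.Analysis.Analytic.Uniqueness
import Mathlib.Analysis.Normed.Unbundled.RingSeminorm
import Mathlib.LinearAlgebra.Matrix.AbsoluteValue
import Mathlib.Tactic
import HarnessLib

/-!
# Borel's rationality theorem — the Hankel determinant estimate

Analytic half of the Borel–Dwork–Pólya rationality theorem (É. Borel 1894; Calegari–Dimitrov–Tang,
arXiv:2408.15403, §1.2 Theorem 3 "Borel–Pólya" in the case of a disc, cf. their §2.1): if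
`f = Σ aₙ xⁿ` has `|aₙ| ≤ C_a ρ⁻ⁿ` and `P·f =: Σ bₙ xⁿ` (for a polynomial `P` of degree `e` with
`P(0) = 1`) has `|bₙ| ≤ C_b R'⁻ⁿ` with `R' > 1`, then the Hankel determinants
`Δₘ = det(a_{i+j})_{0≤i,j≤m}` satisfy
`|Δₘ| ≤ (m+1)! · R'^{-(0+1+⋯+m)} · (C_a ρ^{-2m} R'^{m})^{e} · C_b^{m+1}` (`C_a, C_b ≥ 1`,
`ρ ≤ 1`), which tends to `0` faster than any exponential. For `aₙ ∈ ℤ` this forces `Δₘ = 0`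
for large `m`, and Kronecker's criterion (`KroneckerRationalityCriterion.lean`) gives
rationality (`BorelDworkRationality.lean`).

The proof is the classical one (e.g. Dwork 1960, Koblitz *p-adic Numbers…* Ch. V §5, Borel's
original in the archimedean-only setting): unit upper-triangular column operations replace the
columns `j ≥ e` of the Hankel matrix by the columns `(b_{i+j})ᵢ`; then rows are scaled by
`R'^{i}` and columns by the reciprocal bounds, and Hadamard's crude bound `|det M| ≤ (m+1)!`
for a matrix with entries of modulus `≤ 1` (`Matrix.det_le`) finishes.

## Contents (all proved; no named facts)

* `Borel.exists_norm_mul_pow_le_of_differentiableOn` — Cauchy: if `h` is holomorphic on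
  `|z| < R` with germ `Σ cₙ zⁿ` at `0`, then `‖cₙ‖ rⁿ` is bounded for each `r < R`.
* `Borel.columnOp` and its properties — the unit upper-triangular column operations.
* `Borel.norm_hankelDet_le` — the determinant estimate above.

## References

* É. Borel, *Sur une application d'un théorème de M. Hadamard*, Bull. Sci. Math. 18 (1894).
* B. Dwork, *On the rationality of the zeta function of an algebraic variety*, Amer. J. Math.
  82 (1960), §1 (the rationality criterion); N. Koblitz, *p-adic Numbers, p-adic Analysis, and
  Zeta-Functions*, GTM 58, Ch. V §5.
* [CalegariDimitrovTang2024] arXiv:2408.15403, §1.2 Theorem 3, §2.1.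
-/

noncomputable section

open Filter Metric Finset Matrix
open scoped Topology Nat

namespace Literature.NumberTheory.Transcendental

namespace Borel

/-! ### Cauchy coefficient bounds from holomorphy on a disc -/

/-- **Cauchy's coefficient bound.** If `h` is holomorphic on the disc `|z| < R` and
`h(z) = Σ cₙ zⁿ` near `0`, then for every `0 < r < R` the terms `‖cₙ‖ rⁿ` are bounded (the germ
converges to `h` on every smaller closed disc: `DifferentiableOn.hasFPowerSeriesOnBall` and
uniqueness of the Taylor series). [folklore] -/
theorem exists_norm_mul_pow_le_of_differentiableOn {c : ℕ → ℂ} {R r : ℝ} (hr0 : 0 < r)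
    (hrR : r < R) {h : ℂ → ℂ} (hh : DifferentiableOn ℂ h (ball (0 : ℂ) R))
    (hgerm : ∀ᶠ z in 𝓝 (0 : ℂ), HasSum (fun n => c n * z ^ n) (h z)) :
    ∃ C, 0 ≤ C ∧ ∀ n, ‖c n‖ * r ^ n ≤ C := by
  set q : FormalMultilinearSeries ℂ ℂ ℂ := FormalMultilinearSeries.ofScalars ℂ c with hq
  have hq_apply : ∀ (y : ℂ) (n : ℕ), q n (fun _ => y) = c n * y ^ n := by
    intro y n
    rw [hq, FormalMultilinearSeries.ofScalars_apply_eq, smul_eq_mul]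
  -- Step 1: `h` has `q` as power series at `0`
  obtain ⟨ε, hε0, hε⟩ := Metric.eventually_nhds_iff_ball.mp hgerm
  have hε2 : 0 < ε / 2 := by positivity
  let δ : NNReal := ⟨ε / 2, hε2.le⟩
  have hδcoe : (δ : ℝ) = ε / 2 := rfl
  have hδ : (0 : NNReal) < δ := by
    rw [← NNReal.coe_lt_coe, NNReal.coe_zero, hδcoe]
    exact hε2
  have hsum_half : HasSum (fun n => c n * ((ε / 2 : ℝ) : ℂ) ^ n) (h ((ε / 2 : ℝ) : ℂ)) := by
    apply hε
    rw [mem_ball, dist_zero_right, Complex.norm_real, Real.norm_of_nonneg hε2.le]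
    linarith
  obtain ⟨C₀, hC₀⟩ : ∃ C, ∀ n, ‖c n * ((ε / 2 : ℝ) : ℂ) ^ n‖ ≤ C := by
    obtain ⟨C, hC⟩ := hsum_half.summable.tendsto_atTop_zero.norm.bddAbove_range
    exact ⟨C, fun n => hC ⟨n, rfl⟩⟩
  have hrad : (δ : ENNReal) ≤ q.radius := by
    refine q.le_radius_of_bound C₀ fun n => ?_
    have h1 : ‖q n‖ = ‖c n‖ := by
      rw [hq, FormalMultilinearSeries.ofScalars_norm]
    rw [h1, hδcoe]
    have := hC₀ n
    rw [norm_mul, norm_pow, Complex.norm_real, Real.norm_of_nonneg hε2.le] at this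
    exact this
  have hq_at : HasFPowerSeriesAt h q 0 := by
    refine ⟨δ, hrad, ENNReal.coe_pos.mpr hδ, fun {y} hy => ?_⟩
    rw [zero_add]
    have hy' : y ∈ ball (0 : ℂ) ε := by
      rw [Metric.eball_coe, mem_ball, dist_zero_right] at hy
      rw [mem_ball, dist_zero_right]
      rw [hδcoe] at hy
      linarith
    simpa only [hq_apply] using hε y hy'
  -- Step 2: Cauchy on the closed disc of radius `r' = (r+R)/2`
  set r' : ℝ := (r + R) / 2 with hr'
  have hrr' : r < r' := by rw [hr']; linarith
  have hr'R : r' < R := by rw [hr']; linarith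
  have hr'0 : 0 < r' := by linarith
  let ρ : NNReal := ⟨r', hr'0.le⟩
  have hρcoe : (ρ : ℝ) = r' := rfl
  have hρ : (0 : NNReal) < ρ := by
    rw [← NNReal.coe_lt_coe, NNReal.coe_zero, hρcoe]
    exact hr'0
  have hsub : closedBall (0 : ℂ) ρ ⊆ ball (0 : ℂ) R := closedBall_subset_ball hr'R
  have hcauchy : HasFPowerSeriesOnBall h (cauchyPowerSeries h 0 ρ) 0 ρ :=
    (hh.mono hsub).hasFPowerSeriesOnBall hρ
  have hpq : cauchyPowerSeries h 0 ρ = q :=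
    hcauchy.hasFPowerSeriesAt.eq_formalMultilinearSeries hq_at
  rw [hpq] at hcauchy
  -- Step 3: summability at the real point `r`, hence bounded terms
  have hmem : ((r : ℝ) : ℂ) ∈ Metric.eball (0 : ℂ) ρ := by
    rw [Metric.eball_coe, mem_ball, dist_zero_right, Complex.norm_real,
      Real.norm_of_nonneg hr0.le, hρcoe]
    exact hrr'
  have hsumC : Summable fun n => c n * ((r : ℝ) : ℂ) ^ n := by
    have h := hcauchy.hasSum hmem
    simp only [hq_apply] at h
    exact h.summable
  obtain ⟨C, hC⟩ : ∃ C, ∀ n, ‖c n * ((r : ℝ) : ℂ) ^ n‖ ≤ C := by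
    obtain ⟨C, hC⟩ := hsumC.tendsto_atTop_zero.norm.bddAbove_range
    exact ⟨C, fun n => hC ⟨n, rfl⟩⟩
  refine ⟨max C 0, le_max_right _ _, fun n => ?_⟩
  have := hC n
  rw [norm_mul, norm_pow, Complex.norm_real, Real.norm_of_nonneg hr0.le] at this
  exact this.trans (le_max_left _ _)

/-! ### The column operations -/

/-- The **column-operation matrix**: identity on the columns `j < e`, and for `j ≥ e` the
column `Σ_{t ≤ e} p_t · (column j − t)`; unit upper-triangular when `p 0 = 1`. [folklore] -/
def columnOp (p : ℕ → ℂ) (e m : ℕ) : Matrix (Fin (m + 1)) (Fin (m + 1)) ℂ :=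
  Matrix.of fun l j =>
    if (j : ℕ) < e then (if l = j then 1 else 0)
    else ∑ t ∈ range (e + 1), p t * (if (l : ℕ) + t = j then 1 else 0)

/-- Entries of `columnOp`. [folklore] -/
theorem columnOp_apply (p : ℕ → ℂ) (e m : ℕ) (l j : Fin (m + 1)) :
    columnOp p e m l j = if (j : ℕ) < e then (if l = j then 1 else 0)
      else ∑ t ∈ range (e + 1), p t * (if (l : ℕ) + t = j then 1 else 0) :=
  rfl

/-- `columnOp` is unit upper-triangular, so its determinant is `1`. [folklore] -/
theorem det_columnOp {p : ℕ → ℂ} (hp0 : p 0 = 1) (e m : ℕ) : (columnOp p e m).det = 1 := by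
  have hup : (columnOp p e m).BlockTriangular id := by
    intro l j hlj
    have hlj' : (j : ℕ) < l := hlj
    rw [columnOp_apply]
    by_cases h1 : (j : ℕ) < e
    · rw [if_pos h1, if_neg]
      intro h2
      exact absurd (congrArg Fin.val h2) (by omega)
    · rw [if_neg h1]
      refine Finset.sum_eq_zero fun t _ => ?_
      rw [if_neg (by omega), mul_zero]
  rw [Matrix.det_of_upperTriangular hup]
  refine Finset.prod_eq_one fun j _ => ?_
  rw [columnOp_apply]
  by_cases h1 : (j : ℕ) < e
  · rw [if_pos h1, if_pos rfl]
  · rw [if_neg h1, Finset.sum_eq_single 0]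
    · rw [hp0, if_pos (by omega), mul_one]
    · intro t _ ht
      rw [if_neg (by omega), mul_zero]
    · intro h0
      exact absurd (Finset.mem_range.mpr (Nat.succ_pos e)) h0

/-- **Effect of the column operations on a Hankel matrix**: columns `j < e` are unchanged,
`(A·U)_{ij} = a_{i+j}`. [folklore] -/
theorem hankel_mul_columnOp_of_lt (a p : ℕ → ℂ) {e m : ℕ} (i j : Fin (m + 1))
    (hj : (j : ℕ) < e) : (Kronecker.hankelMatrix a m * columnOp p e m) i j = a (i + j) := by
  rw [Matrix.mul_apply]
  simp only [Kronecker.hankelMatrix_apply, columnOp_apply, if_pos hj, mul_ite, mul_one, mul_zero,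
    Finset.sum_ite_eq', Finset.mem_univ, if_true]

/-- **Effect of the column operations on a Hankel matrix**: for `e ≤ j`,
`(A·U)_{ij} = Σ_{t ≤ e} p_t a_{i+j−t}` (`= b_{i+j}`, the Taylor coefficient of `P·f`).
[folklore] -/
theorem hankel_mul_columnOp_of_le (a p : ℕ → ℂ) {e m : ℕ} (i j : Fin (m + 1))
    (hj : e ≤ (j : ℕ)) : (Kronecker.hankelMatrix a m * columnOp p e m) i j =
      ∑ t ∈ range (e + 1), p t * a ((i : ℕ) + j - t) := by
  rw [Matrix.mul_apply]
  simp only [Kronecker.hankelMatrix_apply, columnOp_apply, if_neg (not_lt.mpr hj),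
    Finset.mul_sum, mul_ite, mul_one, mul_zero]
  rw [Finset.sum_comm]
  refine Finset.sum_congr rfl fun t ht => ?_
  have ht' : t ≤ e := Nat.lt_succ_iff.mp (Finset.mem_range.mp ht)
  have hj' := j.isLt
  have hidx : (j : ℕ) - t < m + 1 := by omega
  rw [show (∑ l : Fin (m + 1), if (l : ℕ) + t = (j : ℕ) then a ((i : ℕ) + l) * p t else 0)
      = ∑ l : Fin (m + 1), if l = ⟨(j : ℕ) - t, hidx⟩ then a ((i : ℕ) + l) * p t else 0 by
    refine Finset.sum_congr rfl fun l _ => ?_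
    have : ((l : ℕ) + t = (j : ℕ)) ↔ l = ⟨(j : ℕ) - t, hidx⟩ := by
      rw [Fin.ext_iff]
      dsimp only
      omega
    simp only [this]]
  rw [Finset.sum_ite_eq' Finset.univ, if_pos (Finset.mem_univ _), mul_comm]
  congr 2
  dsimp only
  omega

/-! ### The determinant estimate -/

/-- **Hadamard's crude bound**: a complex matrix with entries of modulus `≤ 1` has
determinant of modulus `≤ (card)!`. [folklore] -/
theorem norm_det_le_factorial {n : ℕ} (M : Matrix (Fin n) (Fin n) ℂ)
    (hM : ∀ i j, ‖M i j‖ ≤ 1) : ‖M.det‖ ≤ (n ! : ℝ) := by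
  have h := Matrix.det_le (abv := NormedField.toAbsoluteValue ℂ) (A := M) (x := (1 : ℝ))
    (fun i j => by simpa [NormedField.toAbsoluteValue] using hM i j)
  simp only [NormedField.toAbsoluteValue, Fintype.card_fin, one_pow, nsmul_eq_mul,
    mul_one] at h
  exact h

/-- **The Hankel determinant estimate (Borel–Dwork).** Let `a, b : ℕ → ℂ`, `p : ℕ → ℂ` with
`p 0 = 1`, `e : ℕ`, and suppose `bₙ = Σ_{t ≤ e} p_t a_{n−t}` for `n ≥ e` (i.e. `Σ bₙxⁿ` agrees
with `P·f` from degree `e` on, `P = Σ_{t≤e} p_t x^t`). If `‖aₙ‖ ρⁿ ≤ C_a` (`0 < ρ ≤ 1`) and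
`‖bₙ‖ R'ⁿ ≤ C_b` (`R' ≥ 1`), then for `m ≥ e`
`‖Δₘ(a)‖ ≤ (m+1)! · (R'⁻¹)^{0+1+⋯+m} · (max C_a 1 · ρ^{−2m} · R'^{m})^{e} · (max C_b 1)^{m+1}`.
[folklore] -/
theorem norm_hankelDet_le {a b p : ℕ → ℂ} {e : ℕ} (hp0 : p 0 = 1)
    (hb : ∀ n, e ≤ n → b n = ∑ t ∈ range (e + 1), p t * a (n - t))
    {Ca ρ Cb R' : ℝ} (hρ0 : 0 < ρ) (hρ1 : ρ ≤ 1) (hR' : 1 ≤ R')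
    (ha : ∀ n, ‖a n‖ * ρ ^ n ≤ Ca) (hb' : ∀ n, ‖b n‖ * R' ^ n ≤ Cb) {m : ℕ} (hm : e ≤ m) :
    ‖Kronecker.hankelDet a m‖ ≤ (m + 1)! * (R'⁻¹) ^ (∑ i ∈ range (m + 1), i)
      * (max Ca 1 * (ρ⁻¹) ^ (2 * m) * R' ^ m) ^ e * (max Cb 1) ^ (m + 1) := by
  have hR'0 : 0 < R' := by linarith
  have hρinv1 : 1 ≤ ρ⁻¹ := one_le_inv_iff₀.mpr ⟨hρ0, hρ1⟩
  have hR'inv1 : R'⁻¹ ≤ 1 := inv_le_one_of_one_le₀ hR'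
  have hR'inv0 : 0 < R'⁻¹ := by positivity
  -- pointwise bounds `‖a n‖ ≤ Ca ρ⁻ⁿ`, `‖b n‖ ≤ Cb R'⁻ⁿ`
  have ha' : ∀ n, ‖a n‖ ≤ Ca * (ρ⁻¹) ^ n := by
    intro n
    have h := ha n
    have hρn : 0 < ρ ^ n := by positivity
    rw [inv_pow, ← div_eq_mul_inv, le_div_iff₀ hρn]
    exact h
  have hb'' : ∀ n, ‖b n‖ ≤ Cb * (R'⁻¹) ^ n := by
    intro n
    have h := hb' n
    have hRn : 0 < R' ^ n := by positivity
    rw [inv_pow, ← div_eq_mul_inv, le_div_iff₀ hRn]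
    exact h
  have hCa0 : 0 ≤ Ca := le_trans (by positivity) (ha 0)
  have hCb0 : 0 ≤ Cb := le_trans (by positivity) (hb' 0)
  -- the scalings
  set Ka : ℝ := max Ca 1 * (ρ⁻¹) ^ (2 * m) * R' ^ m with hKa
  set Kb : ℝ := max Cb 1 with hKb
  have hKa1 : 1 ≤ Ka := by
    rw [hKa]
    have h1 : (1 : ℝ) ≤ max Ca 1 := le_max_right _ _
    have h2 : (1 : ℝ) ≤ (ρ⁻¹) ^ (2 * m) := one_le_pow₀ hρinv1
    have h3 : (1 : ℝ) ≤ R' ^ m := one_le_pow₀ hR'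
    calc (1 : ℝ) = 1 * 1 * 1 := by ring
      _ ≤ max Ca 1 * (ρ⁻¹) ^ (2 * m) * R' ^ m := by gcongr
  have hKa0 : 0 < Ka := by linarith
  have hKb1 : 1 ≤ Kb := le_max_right _ _
  have hKb0 : 0 < Kb := by linarith
  let r : Fin (m + 1) → ℝ := fun i => (R'⁻¹) ^ (i : ℕ)
  let c : Fin (m + 1) → ℝ := fun j => if (j : ℕ) < e then Ka else Kb
  have hr0 : ∀ i, 0 < r i := fun i => by positivity
  have hc0 : ∀ j, 0 < c j := fun j => by
    simp only [c]; split_ifs <;> assumption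
  -- the matrices
  set A : Matrix (Fin (m + 1)) (Fin (m + 1)) ℂ := Kronecker.hankelMatrix a m with hA
  set U : Matrix (Fin (m + 1)) (Fin (m + 1)) ℂ := columnOp p e m with hU
  set M : Matrix (Fin (m + 1)) (Fin (m + 1)) ℂ :=
    Matrix.of fun i j => ((r i : ℝ) : ℂ)⁻¹ * (A * U) i j * ((c j : ℝ) : ℂ)⁻¹ with hM
  -- entry bound `‖(A U) i j‖ ≤ r i * c j`
  have hAU : ∀ i j, ‖(A * U) i j‖ ≤ r i * c j := by
    intro i j
    have hi := i.isLt
    have hj := j.isLt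
    by_cases hje : (j : ℕ) < e
    · rw [hA, hU, hankel_mul_columnOp_of_lt a p i j hje]
      simp only [c, if_pos hje, r]
      calc ‖a (i + j)‖ ≤ Ca * (ρ⁻¹) ^ ((i : ℕ) + j) := ha' _
        _ ≤ max Ca 1 * (ρ⁻¹) ^ (2 * m) := by
            gcongr
            · exact le_max_left _ _
            · omega
        _ = max Ca 1 * (ρ⁻¹) ^ (2 * m) * 1 := (mul_one _).symm
        _ ≤ max Ca 1 * (ρ⁻¹) ^ (2 * m) * ((R'⁻¹) ^ (i : ℕ) * R' ^ m) := by
            gcongr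
            -- `1 ≤ R'⁻ⁱ R'ᵐ` since `i ≤ m`
            have : (R'⁻¹) ^ (i : ℕ) * R' ^ m = R' ^ (m - i) := by
              rw [inv_pow, ← div_eq_inv_mul, div_eq_iff (by positivity), ← pow_add]
              congr 1; omega
            rw [this]
            exact one_le_pow₀ hR'
        _ = (R'⁻¹) ^ (i : ℕ) * (max Ca 1 * (ρ⁻¹) ^ (2 * m) * R' ^ m) := by ring
    · rw [hA, hU, hankel_mul_columnOp_of_le a p i j (not_lt.mp hje), ← hb _ (by omega)]
      simp only [c, if_neg hje, r]
      calc ‖b ((i : ℕ) + j)‖ ≤ Cb * (R'⁻¹) ^ ((i : ℕ) + j) := hb'' _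
        _ ≤ Cb * (R'⁻¹) ^ (i : ℕ) :=
            mul_le_mul_of_nonneg_left
              (pow_le_pow_of_le_one hR'inv0.le hR'inv1 (by omega : (i : ℕ) ≤ i + j)) hCb0
        _ ≤ Kb * (R'⁻¹) ^ (i : ℕ) := by gcongr; exact le_max_left _ _
        _ = (R'⁻¹) ^ (i : ℕ) * Kb := mul_comm _ _
  -- hence `‖M i j‖ ≤ 1`
  have hM1 : ∀ i j, ‖M i j‖ ≤ 1 := by
    intro i j
    have hri := hr0 i
    have hcj := hc0 j
    have h := hAU i j
    have hMij : M i j = ((r i : ℝ) : ℂ)⁻¹ * (A * U) i j * ((c j : ℝ) : ℂ)⁻¹ := rfl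
    rw [hMij, norm_mul, norm_mul, norm_inv, norm_inv, Complex.norm_real, Complex.norm_real,
      Real.norm_of_nonneg hri.le, Real.norm_of_nonneg hcj.le]
    calc (r i)⁻¹ * ‖(A * U) i j‖ * (c j)⁻¹ ≤ (r i)⁻¹ * (r i * c j) * (c j)⁻¹ := by gcongr
      _ = 1 := by field_simp
  -- `A U = diag r * M * diag c`
  have hfactor : A * U = Matrix.diagonal (fun i => ((r i : ℝ) : ℂ)) * M
      * Matrix.diagonal (fun j => ((c j : ℝ) : ℂ)) := by
    ext i j
    rw [Matrix.mul_diagonal, Matrix.diagonal_mul, hM, Matrix.of_apply]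
    have hri : ((r i : ℝ) : ℂ) ≠ 0 := Complex.ofReal_ne_zero.mpr (hr0 i).ne'
    have hcj : ((c j : ℝ) : ℂ) ≠ 0 := Complex.ofReal_ne_zero.mpr (hc0 j).ne'
    field_simp
  -- determinants
  have hdetAU : (A * U).det = A.det := by
    rw [Matrix.det_mul, hU, det_columnOp hp0, mul_one]
  have hdet : A.det = (∏ i, ((r i : ℝ) : ℂ)) * M.det * ∏ j, ((c j : ℝ) : ℂ) := by
    rw [← hdetAU, hfactor, Matrix.det_mul, Matrix.det_mul, Matrix.det_diagonal,
      Matrix.det_diagonal]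
  have hnorm : ‖A.det‖ ≤ (∏ i, r i) * (m + 1)! * ∏ j, c j := by
    rw [hdet, norm_mul, norm_mul]
    have h1 : ‖∏ i, ((r i : ℝ) : ℂ)‖ = ∏ i, r i := by
      rw [← Complex.ofReal_prod, Complex.norm_real,
        Real.norm_of_nonneg (Finset.prod_nonneg fun i _ => (hr0 i).le)]
    have h2 : ‖∏ j, ((c j : ℝ) : ℂ)‖ = ∏ j, c j := by
      rw [← Complex.ofReal_prod, Complex.norm_real,
        Real.norm_of_nonneg (Finset.prod_nonneg fun j _ => (hc0 j).le)]
    rw [h1, h2]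
    have h3 : ‖M.det‖ ≤ ((m + 1)! : ℝ) := norm_det_le_factorial M hM1
    have h4 : 0 ≤ ∏ i, r i := Finset.prod_nonneg fun i _ => (hr0 i).le
    have h5 : 0 ≤ ∏ j, c j := Finset.prod_nonneg fun j _ => (hc0 j).le
    gcongr
  -- the products of the scalings
  have hprod_r : ∏ i : Fin (m + 1), r i = (R'⁻¹) ^ (∑ i ∈ range (m + 1), i) := by
    simp only [r]
    rw [Finset.prod_pow_eq_pow_sum, Fin.sum_univ_eq_sum_range (fun i => i) (m + 1)]
  have hprod_c : ∏ j : Fin (m + 1), c j ≤ Ka ^ e * Kb ^ (m + 1) := by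
    simp only [c]
    rw [Fin.prod_univ_eq_prod_range (fun j => if j < e then Ka else Kb) (m + 1),
      Finset.range_eq_Ico,
      ← Finset.prod_Ico_consecutive _ (Nat.zero_le e) (by omega : e ≤ m + 1)]
    have h1 : ∏ j ∈ Ico 0 e, (if j < e then Ka else Kb) = Ka ^ e := by
      rw [Finset.prod_congr rfl (fun j hj => if_pos (Finset.mem_Ico.mp hj).2),
        Finset.prod_const, Nat.card_Ico, Nat.sub_zero]
    have h2 : ∏ j ∈ Ico e (m + 1), (if j < e then Ka else Kb) = Kb ^ (m + 1 - e) := by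
      rw [Finset.prod_congr rfl (fun j hj => if_neg (not_lt.mpr (Finset.mem_Ico.mp hj).1)),
        Finset.prod_const, Nat.card_Ico]
    rw [h1, h2]
    have hKa0' : 0 ≤ Ka ^ e := by positivity
    have : Kb ^ (m + 1 - e) ≤ Kb ^ (m + 1) := pow_le_pow_right₀ hKb1 (by omega)
    exact mul_le_mul_of_nonneg_left this hKa0'
  -- assemble
  have hfact0 : (0 : ℝ) ≤ (∏ i, r i) * (m + 1)! :=
    mul_nonneg (Finset.prod_nonneg fun i _ => (hr0 i).le) (by positivity)
  calc ‖Kronecker.hankelDet a m‖ = ‖A.det‖ := rfl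
    _ ≤ (∏ i, r i) * (m + 1)! * ∏ j, c j := hnorm
    _ ≤ (∏ i, r i) * (m + 1)! * (Ka ^ e * Kb ^ (m + 1)) :=
        mul_le_mul_of_nonneg_left hprod_c hfact0
    _ = (m + 1)! * (R'⁻¹) ^ (∑ i ∈ range (m + 1), i) * Ka ^ e * Kb ^ (m + 1) := by
        rw [hprod_r]; ring

end Borel

end Literature.NumberTheory.Transcendental
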